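import Literature.NumberTheory.IwasawaTheory.ClassGroupPRankSmallRankCriterion
import Summits.BirchSwinnertonDyer.BirchSwinnertonDyer.Theorems.ByReductionTypeAtTwoAdditivePotGoodLowerHalfT0RankFormRowsD
import Summits.BirchSwinnertonDyer.BirchSwinnertonDyer.Theorems.ByReductionTypeAtTwoAdditivePotGoodLowerHalfT0RankFormRowsE
import HarnessLib

/-!
# K4 crux `AdditiveRankZeroAtTwo` (19098), child C3″ `AdditivePotGoodLowerHalfAtTwo` (item 22617): the SMALL-RANK ROAD on the `Δ_cubic < 0` OPEN-TYPE rows —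
# (A)₂ and the BSD₂ rungs WITHOUT ANY PRINT FACT for (A), modulo ONE displayed INSTRUMENT INEQUALITY on ONE layer of the cubic tower
# (`rank₂ Cl(ℚ(θ)·ℚ_j) < 2^j − 1`; file D of the `SmallRankRows` series A–D; seat `bsd-2adic-k4-w2` GEN 11; `--supports stmt-BirchSwinnertonDyer-22617 --as helper`)

Cell `bsd-2adic`. The tree holds a PROVED one-layer criterion for `μ = 0` (`Literature/NumberTheory/IwasawaTheory/ClassGroupPRankSmallRankCriterion.lean`,
`classicalMuVanishes_of_lt_pow_sub_one`: `TotallyRamifiedFrom κ n₀`, `n₀ ≤ n`, `rank_p Cl(K_{n+j}) < p^j − 1` for ONE `j` ⟹ `μ_p(κ) = 0`; Washington §13.3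
Lemma 13.18 / Prop. 13.22–13.23 at finite level, Fukuda's method) — it needs ONE layer with SMALL rank and tolerates any growth below it, where Fukuda's
Thm. 1 (2) needs two consecutive layers with EQUAL ranks. With Fukuda's index `n₀ = 0` now KERNEL on these rows (GEN 11 `…LowerHalfT0RankFormRows{B,C,D,E}`:
`forall_totallyRamifiedFrom_zero_h<L>`; here for `412400n1` by the odd polynomial discriminant), `p = 2`, `n = 0`, `j = 2` reads: **`rank₂ Cl(ℚ(θ)·ℚ₂) ≤ 2 ⟹
μ₂(ℚ(θ)_cyc) = 0`** (one number field of degree `12`), and `j = 3`: `rank₂ Cl(ℚ(θ)·ℚ₃) ≤ 6` (degree `24`). Rows of this file: `315832c1`, `288648g1`.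
* §1 per row: the μ-INTERFACE `AddKatoTwo.conjA_two_<L>_of_classicalMu hθ hμ` ((A)₂ ⟸ `μ₂ = 0` along every cyclotomic `ℤ₂`-extension of the cubic point field,
  through cruxlead-19573-w2's `ℓ = 2` ascent p728213 — the exact `θ ↔ x(P)` change of generator is done once here, so that any future source of `μ₂ = 0` plugs in
  by name), and the one-layer stamp `AddKatoTwo.conjA_two_<L>_of_rankLe₂ hθ h2` (`_of_rankLe₃ hθ h3` for `412400n1`).
* §2 per row: GEN 3's rungs re-keyed — `AddPotGoodInstances.bsdp_two_<L>_rankLe₂`, `bsdp_two_of_isIsogenous_<L>_rankLe₂` (BSD₂ on the class ⟸ PRINT {hSharp (reading),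
  hGZK, hmod, hCT(, hCassels)} + RECORD {r_an = 0, #Ш_an = q, ord₂ q ≤ 6} + the two VALUED Selmer slots + ONE instrument inequality).

HONEST FRAMING (D-0036 / D-0054 / D-0152): conditional theorems; the displayed inequality is an INSTRUMENT-tier numeric input (the `2`-rank of the class group
of ONE number field of degree `12` — `24` for `412400n1` —, PARI `bnfinit`, GRH-conditional in the kit runs `j300990` / `j301920`; an UPPER bound on a `2`-rank is
not certified in the kernel) — NOT a fact from print; `hSharp` is the Kato-at-`2` SHARP reading (D-audit PASS). Compared with the rank-form stamps the input
shrinks from the exact ranks of TWO fields to an upper bound on ONE field. Closes nothing at the `∀`-level (C3″ 22617 / C1″ 22615 OPEN); nothing booked (D-0054);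
no rung moves; BSD is not proved by any of this. THEOREMS ONLY (no `def`).

References: [Washington1997] §13.3 Lemmas 13.15, 13.18, Prop. 13.22, 13.23; [Fukuda1994] Thm. 1 (2), p. 264; [Iwasawa1973MuInvariants] Thm. 2/3;
[CoatesSujatha2005] (A), Thm. 3.4; [Kato2004Asterisque] Thm. 12.5 (1)(3), 13.8, 14.14; [Cassels1965ArithmeticVIII] Thm. 1.3; [Miller2011LMS] Def. 1.1.
-/

set_option autoImplicit false
-- the Theorems namespace of this sub repeats the summit name by design (D-0017 nested layout)
set_option linter.dupNamespace false

noncomputable section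

open scoped Classical IntermediateField NumberField Real nonZeroDivisors

/-! ## §1 μ-interfaces and one-layer stamps (namespace `AddKatoTwo`) -/

namespace Summit.BirchSwinnertonDyer.BirchSwinnertonDyer.Theorems.AddKatoTwo

open WeierstrassCurve Field Polynomial IsDedekindDomain NumberField Matrix Literature.NumberTheory.EllipticCurves
  Literature.NumberTheory.GaloisRepresentations
  Literature.NumberTheory.IwasawaTheory
  Summit.BirchSwinnertonDyer.BirchSwinnertonDyer.Theorems.SteinbergFibreAtTwo
  Summit.BirchSwinnertonDyer.BirchSwinnertonDyer.Theorems.AlignedTransportAtTwoTorsionPointField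
  Summit.BirchSwinnertonDyer.BirchSwinnertonDyer.Theses.ByReductionTypeAtTwo

/-- **A monic integer cubic with a root `β` of degree `3` is irreducible** (restated to keep this file's imports minimal). [folklore] -/
private theorem irreducibleCubic_of_finrank_three_srD {p q r : ℤ} {β : AlgebraicClosure ℚ}
    (hβ : aeval β (Cubic.toPoly ⟨1, (p : ℚ), q, r⟩) = 0) (h3 : Module.finrank ℚ (IntermediateField.adjoin ℚ {β}) = 3) :
    Irreducible (Cubic.toPoly ⟨1, (p : ℚ), q, r⟩) := by
  have hfm : (Cubic.toPoly ⟨1, (p : ℚ), q, r⟩).Monic := Cubic.monic_of_a_eq_one'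
  have hβint : IsIntegral ℚ β := ⟨_, hfm, by rwa [← aeval_def]⟩
  have hdeg : (minpoly ℚ β).natDegree = (Cubic.toPoly ⟨1, (p : ℚ), q, r⟩).natDegree := by
    rw [← IntermediateField.adjoin.finrank hβint, h3, Cubic.natDegree_of_a_ne_zero' one_ne_zero]
  have heq : Cubic.toPoly ⟨1, (p : ℚ), q, r⟩ = minpoly ℚ β :=
    Polynomial.eq_of_monic_of_dvd_of_natDegree_le (minpoly.monic hβint) hfm (minpoly.dvd ℚ β hβ) hdeg.ge
  rw [heq]
  exact minpoly.irreducible hβint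

/-- **THE μ-INTERFACE of `315832c1`, KERNEL**: (A) at `2` (`∃ γ D` form, every cyclotomic `κ` over `ℚ`) for the cast cubic model of `315832c1` from
`μ₂ = 0` along every cyclotomic `ℤ₂`-extension of the CUBIC point field `ℚ(θ)` (`θ` any root of `X³ + (-1)X² + (-24)X + (88)`; `ℚ(P) = ℚ(β) = ℚ(θ)` with
`β = x(P) = -8005 + (1622)θ + (457)θ²` a root of the `2`-division cubic — exact change of generator) through cruxlead-19573-w2's `ℓ = 2` ascent to the totally complex
`ℚ(E[2])` (`Δ_cubic < 0`) and the guarded kernel Lim 3.5@2 (`TotallyComplexMu.conjA_two_cubicModel_of_classicalMu_of_discr_neg`, p728213). Any source of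
`μ₂(ℚ(θ)_cyc) = 0` (Fukuda two-layer, one-layer small rank, capitulation, …) plugs in by name. No print fact. BSD for `315832c1` is NOT proved by this.
[cite: CoatesSujatha2005, Conj. A and Thm. 3.4] [cite: Iwasawa1973MuInvariants, Thm. 2 and Thm. 3] -/
theorem conjA_two_315832c1_of_classicalMu
    {θ : AlgebraicClosure ℚ} (hθ : aeval θ (Cubic.toPoly ⟨1, ((-1 : ℤ) : ℚ), ((-24 : ℤ) : ℚ), ((88 : ℤ) : ℚ)⟩) = 0)
    (hμ : haveI : FiniteDimensional ℚ (IntermediateField.adjoin ℚ {θ}) :=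
        IntermediateField.adjoin.finiteDimensional ((AlgebraicClosure.isAlgebraic ℚ).isAlgebraic θ).isIntegral
      haveI : NumberField (IntermediateField.adjoin ℚ {θ}) := NumberField.mk
      ∀ κL : ZpExtension (IntermediateField.adjoin ℚ {θ}) 2, κL.IsCyclotomic → ClassicalMuVanishes κL)
    (κ : ZpExtension ℚ 2) (hκ : κ.IsCyclotomic) :
    haveI := (isElliptic_cubicModel _ _ _ (by simp only [Cubic.discr]; norm_num) : (⟨0, ((0 : ℤ) : ℚ), 0, ((79574117 : ℤ) : ℚ), ((176712113750 : ℤ) : ℚ)⟩ : WeierstrassCurve ℚ).IsElliptic)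
    ∃ (γ : absoluteGaloisGroup ℚ) (D : (⟨0, ((0 : ℤ) : ℚ), 0, ((79574117 : ℤ) : ℚ), ((176712113750 : ℤ) : ℚ)⟩ : WeierstrassCurve ℚ).FineSelmerDualData κ γ),
      Module.Finite ℤ_[2] (RestrictScalars ℤ_[2] (IwasawaAlgebra 2) D.X) := by
  haveI := (isElliptic_cubicModel _ _ _ (by simp only [Cubic.discr]; norm_num) : (⟨0, ((0 : ℤ) : ℚ), 0, ((79574117 : ℤ) : ℚ), ((176712113750 : ℤ) : ℚ)⟩ : WeierstrassCurve ℚ).IsElliptic)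
  have hθ' : θ ^ 3 + (-1 : AlgebraicClosure ℚ) * θ ^ 2 + (-24 : AlgebraicClosure ℚ) * θ + (88 : AlgebraicClosure ℚ) = 0 := by
    have := hθ
    simp only [Cubic.toPoly, map_one, one_mul, aeval_add, aeval_mul, aeval_C, aeval_X_pow, aeval_X,
      eq_ratCast, Rat.cast_intCast] at this
    push_cast at this
    linear_combination this
  set β : AlgebraicClosure ℚ := algebraMap ℚ (AlgebraicClosure ℚ) (-8005 : ℚ) +
      algebraMap ℚ (AlgebraicClosure ℚ) (1622 : ℚ) * θ + algebraMap ℚ (AlgebraicClosure ℚ) (457 : ℚ) * θ ^ 2 with hβdef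
  have hβ : aeval β (Cubic.toPoly ⟨1, ((0 : ℤ) : ℚ), ((79574117 : ℤ) : ℚ), ((176712113750 : ℤ) : ℚ)⟩) = 0 := by
    simp only [Cubic.toPoly, map_one, one_mul, aeval_add, aeval_mul, aeval_C, aeval_X_pow, aeval_X, eq_ratCast,
      Rat.cast_intCast]
    rw [hβdef]
    simp only [eq_ratCast]
    push_cast
    linear_combination ((-11059537420 : AlgebraicClosure ℚ) + (1993792288 : AlgebraicClosure ℚ) * θ + (1111703227 : AlgebraicClosure ℚ) * θ ^ 2 + (95443993 : AlgebraicClosure ℚ) * θ ^ 3) * hθ'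
  have hadj : IntermediateField.adjoin ℚ {β} = IntermediateField.adjoin ℚ {θ} := by
    apply le_antisymm
    · rw [IntermediateField.adjoin_simple_le_iff, hβdef]
      have hθmem := IntermediateField.mem_adjoin_simple_self ℚ θ
      exact add_mem (add_mem (algebraMap_mem _ _) (mul_mem (algebraMap_mem _ _) hθmem))
        (mul_mem (algebraMap_mem _ _) (pow_mem hθmem 2))
    · rw [IntermediateField.adjoin_simple_le_iff]
      have hθeq : θ = algebraMap ℚ (AlgebraicClosure ℚ) (-11290287726 / 2494508291 : ℚ) +
          algebraMap ℚ (AlgebraicClosure ℚ) (2018047 / 4989016582 : ℚ) * β +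
          algebraMap ℚ (AlgebraicClosure ℚ) (-457 / 4989016582 : ℚ) * β ^ 2 := by
        rw [hβdef]; simp only [eq_ratCast]; push_cast
        linear_combination (((772950149 : AlgebraicClosure ℚ) / 4989016582) + ((95443993 : AlgebraicClosure ℚ) / 4989016582) * θ) * hθ'
      rw [hθeq]
      have hβmem := IntermediateField.mem_adjoin_simple_self ℚ β
      exact add_mem (add_mem (algebraMap_mem _ _) (mul_mem (algebraMap_mem _ _) hβmem))
        (mul_mem (algebraMap_mem _ _) (pow_mem hβmem 2))
  haveI : FiniteDimensional ℚ (IntermediateField.adjoin ℚ {θ}) :=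
    IntermediateField.adjoin.finiteDimensional ((AlgebraicClosure.isAlgebraic ℚ).isAlgebraic θ).isIntegral
  haveI : NumberField (IntermediateField.adjoin ℚ {θ}) := NumberField.mk
  have h3 := finrank_adjoin_eq_three_of_irreducible irreducible_cubic_h315832c1 hθ
  have h3β : Module.finrank ℚ (IntermediateField.adjoin ℚ {β}) = 3 := by rw [hadj]; exact h3
  exact TotallyComplexMu.conjA_two_cubicModel_of_classicalMu_of_discr_neg (0) (79574117) (176712113750)
    (irreducibleCubic_of_finrank_three_srD hβ h3β) (by simp only [Cubic.discr]; norm_num) hβ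
    (by rw [hadj]; exact hμ) κ hκ

/-- **(A)₂ for `315832c1` WITHOUT any print fact — ONE displayed INSTRUMENT INEQUALITY on ONE layer** (open-type row of the C1″ census:
`d = −28712`, `2 = 𝔭²𝔮`, `h = 1`; tower ranks 0 / 1 / 1): along every cyclotomic `ℤ₂`-extension of `ℚ(θ)` (`θ` any root of `X³ + (-1)X² + (-24)X + (88)`, `ℚ(P) = ℚ(θ)`),
`rank₂ Cl(layer 2) ≤ 2` — the `2`-rank of the class group of ONE number field of degree `12` (instrument tier: PARI `bnfinit`, GRH-conditional; cell TSVs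
`addL2x/gen8/conjA3_census_j300990_classes.tsv` / `conjA4_full_j301920_classes.tsv`). KERNEL: `n₀ = 0` (`forall_totallyRamifiedFrom_zero_h315832c1`), the tree's
ONE-LAYER SMALL-RANK CRITERION `classicalMuVanishes_of_lt_pow_sub_one` (`rank₂ Cl(K_j) < 2^j − 1 ⟹ μ₂ = 0`; Washington §13.3 / Fukuda, finite level) and the
μ-interface `conjA_two_315832c1_of_classicalMu`. Growth of the ranks BELOW layer `2` is irrelevant. No `hLim2`, no Fukuda fact, no ramification bit, no second layer.
BSD for `315832c1` is NOT proved by this. [cite: Washington1997, §13.3 Lemma 13.18 and Prop. 13.22–13.23] [cite: Fukuda1994, Thm. 1 (2), p. 264]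
[cite: CoatesSujatha2005, Conj. A and Thm. 3.4] -/
theorem conjA_two_315832c1_of_rankLe₂
    {θ : AlgebraicClosure ℚ} (hθ : aeval θ (Cubic.toPoly ⟨1, ((-1 : ℤ) : ℚ), ((-24 : ℤ) : ℚ), ((88 : ℤ) : ℚ)⟩) = 0)
    (h2 : haveI : FiniteDimensional ℚ (IntermediateField.adjoin ℚ {θ}) :=
        IntermediateField.adjoin.finiteDimensional ((AlgebraicClosure.isAlgebraic ℚ).isAlgebraic θ).isIntegral
      haveI : NumberField (IntermediateField.adjoin ℚ {θ}) := NumberField.mk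
      ∀ κL : ZpExtension (IntermediateField.adjoin ℚ {θ}) 2, κL.IsCyclotomic → classGroupPRank κL 2 ≤ 2)
    (κ : ZpExtension ℚ 2) (hκ : κ.IsCyclotomic) :
    haveI := (isElliptic_cubicModel _ _ _ (by simp only [Cubic.discr]; norm_num) : (⟨0, ((0 : ℤ) : ℚ), 0, ((79574117 : ℤ) : ℚ), ((176712113750 : ℤ) : ℚ)⟩ : WeierstrassCurve ℚ).IsElliptic)
    ∃ (γ : absoluteGaloisGroup ℚ) (D : (⟨0, ((0 : ℤ) : ℚ), 0, ((79574117 : ℤ) : ℚ), ((176712113750 : ℤ) : ℚ)⟩ : WeierstrassCurve ℚ).FineSelmerDualData κ γ),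
      Module.Finite ℤ_[2] (RestrictScalars ℤ_[2] (IwasawaAlgebra 2) D.X) := by
  haveI : FiniteDimensional ℚ (IntermediateField.adjoin ℚ {θ}) :=
    IntermediateField.adjoin.finiteDimensional ((AlgebraicClosure.isAlgebraic ℚ).isAlgebraic θ).isIntegral
  haveI : NumberField (IntermediateField.adjoin ℚ {θ}) := NumberField.mk
  exact conjA_two_315832c1_of_classicalMu hθ (fun κL hκL => classicalMuVanishes_of_lt_pow_sub_one κL
    (forall_totallyRamifiedFrom_zero_h315832c1 hθ κL hκL) le_rfl (j := 2) (by have h := h2 κL hκL; norm_num; omega)) κ hκ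

/-- **THE μ-INTERFACE of `288648g1`, KERNEL**: (A) at `2` (`∃ γ D` form, every cyclotomic `κ` over `ℚ`) for the cast cubic model of `288648g1` from
`μ₂ = 0` along every cyclotomic `ℤ₂`-extension of the CUBIC point field `ℚ(θ)` (`θ` any root of `X³ + (-1)X² + (1)X + (-49)`; `ℚ(P) = ℚ(β) = ℚ(θ)` with
`β = x(P) = -2399/2 + (3624)θ + (51/2)θ²` a root of the `2`-division cubic — exact change of generator) through cruxlead-19573-w2's `ℓ = 2` ascent to the totally complex
`ℚ(E[2])` (`Δ_cubic < 0`) and the guarded kernel Lim 3.5@2 (`TotallyComplexMu.conjA_two_cubicModel_of_classicalMu_of_discr_neg`, p728213). Any source of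
`μ₂(ℚ(θ)_cyc) = 0` (Fukuda two-layer, one-layer small rank, capitulation, …) plugs in by name. No print fact. BSD for `288648g1` is NOT proved by this.
[cite: CoatesSujatha2005, Conj. A and Thm. 3.4] [cite: Iwasawa1973MuInvariants, Thm. 2 and Thm. 3] -/
theorem conjA_two_288648g1_of_classicalMu
    {θ : AlgebraicClosure ℚ} (hθ : aeval θ (Cubic.toPoly ⟨1, ((-1 : ℤ) : ℚ), ((1 : ℤ) : ℚ), ((-49 : ℤ) : ℚ)⟩) = 0)
    (hμ : haveI : FiniteDimensional ℚ (IntermediateField.adjoin ℚ {θ}) :=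
        IntermediateField.adjoin.finiteDimensional ((AlgebraicClosure.isAlgebraic ℚ).isAlgebraic θ).isIntegral
      haveI : NumberField (IntermediateField.adjoin ℚ {θ}) := NumberField.mk
      ∀ κL : ZpExtension (IntermediateField.adjoin ℚ {θ}) 2, κL.IsCyclotomic → ClassicalMuVanishes κL)
    (κ : ZpExtension ℚ 2) (hκ : κ.IsCyclotomic) :
    haveI := (isElliptic_cubicModel _ _ _ (by simp only [Cubic.discr]; norm_num) : (⟨0, ((0 : ℤ) : ℚ), 0, ((-4738251 : ℤ) : ℚ), ((-2352695501738 : ℤ) : ℚ)⟩ : WeierstrassCurve ℚ).IsElliptic)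
    ∃ (γ : absoluteGaloisGroup ℚ) (D : (⟨0, ((0 : ℤ) : ℚ), 0, ((-4738251 : ℤ) : ℚ), ((-2352695501738 : ℤ) : ℚ)⟩ : WeierstrassCurve ℚ).FineSelmerDualData κ γ),
      Module.Finite ℤ_[2] (RestrictScalars ℤ_[2] (IwasawaAlgebra 2) D.X) := by
  haveI := (isElliptic_cubicModel _ _ _ (by simp only [Cubic.discr]; norm_num) : (⟨0, ((0 : ℤ) : ℚ), 0, ((-4738251 : ℤ) : ℚ), ((-2352695501738 : ℤ) : ℚ)⟩ : WeierstrassCurve ℚ).IsElliptic)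
  have hθ' : θ ^ 3 + (-1 : AlgebraicClosure ℚ) * θ ^ 2 + (1 : AlgebraicClosure ℚ) * θ + (-49 : AlgebraicClosure ℚ) = 0 := by
    have := hθ
    simp only [Cubic.toPoly, map_one, one_mul, aeval_add, aeval_mul, aeval_C, aeval_X_pow, aeval_X,
      eq_ratCast, Rat.cast_intCast] at this
    push_cast at this
    linear_combination this
  set β : AlgebraicClosure ℚ := algebraMap ℚ (AlgebraicClosure ℚ) (-2399 / 2 : ℚ) +
      algebraMap ℚ (AlgebraicClosure ℚ) (3624 : ℚ) * θ + algebraMap ℚ (AlgebraicClosure ℚ) (51 / 2 : ℚ) * θ ^ 2 with hβdef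
  have hβ : aeval β (Cubic.toPoly ⟨1, ((0 : ℤ) : ℚ), ((-4738251 : ℤ) : ℚ), ((-2352695501738 : ℤ) : ℚ)⟩) = 0 := by
    simp only [Cubic.toPoly, map_one, one_mul, aeval_add, aeval_mul, aeval_C, aeval_X_pow, aeval_X, eq_ratCast,
      Rat.cast_intCast]
    rw [hβdef]
    simp only [eq_ratCast]
    push_cast
    linear_combination (((383467397643 : AlgebraicClosure ℚ) / 8) + ((8075462859 : AlgebraicClosure ℚ) / 8) * θ + ((56688795 : AlgebraicClosure ℚ) / 8) * θ ^ 2 + ((132651 : AlgebraicClosure ℚ) / 8) * θ ^ 3) * hθ'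
  have hadj : IntermediateField.adjoin ℚ {β} = IntermediateField.adjoin ℚ {θ} := by
    apply le_antisymm
    · rw [IntermediateField.adjoin_simple_le_iff, hβdef]
      have hθmem := IntermediateField.mem_adjoin_simple_self ℚ θ
      exact add_mem (add_mem (algebraMap_mem _ _) (mul_mem (algebraMap_mem _ _) hθmem))
        (mul_mem (algebraMap_mem _ _) (pow_mem hθmem 2))
    · rw [IntermediateField.adjoin_simple_le_iff]
      have hθeq : θ = algebraMap ℚ (AlgebraicClosure ℚ) (5390080523 / 16089691302 : ℚ) +
          algebraMap ℚ (AlgebraicClosure ℚ) (8838017 / 32179382604 : ℚ) * β +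
          algebraMap ℚ (AlgebraicClosure ℚ) (-17 / 32179382604 : ℚ) * β ^ 2 := by
        rw [hβdef]; simp only [eq_ratCast]; push_cast
        linear_combination (((1401361 : AlgebraicClosure ℚ) / 14301947824) + ((4913 : AlgebraicClosure ℚ) / 14301947824) * θ) * hθ'
      rw [hθeq]
      have hβmem := IntermediateField.mem_adjoin_simple_self ℚ β
      exact add_mem (add_mem (algebraMap_mem _ _) (mul_mem (algebraMap_mem _ _) hβmem))
        (mul_mem (algebraMap_mem _ _) (pow_mem hβmem 2))
  haveI : FiniteDimensional ℚ (IntermediateField.adjoin ℚ {θ}) :=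
    IntermediateField.adjoin.finiteDimensional ((AlgebraicClosure.isAlgebraic ℚ).isAlgebraic θ).isIntegral
  haveI : NumberField (IntermediateField.adjoin ℚ {θ}) := NumberField.mk
  have h3 := finrank_adjoin_eq_three_of_irreducible irreducible_cubic_h288648g1 hθ
  have h3β : Module.finrank ℚ (IntermediateField.adjoin ℚ {β}) = 3 := by rw [hadj]; exact h3
  exact TotallyComplexMu.conjA_two_cubicModel_of_classicalMu_of_discr_neg (0) (-4738251) (-2352695501738)
    (irreducibleCubic_of_finrank_three_srD hβ h3β) (by simp only [Cubic.discr]; norm_num) hβ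
    (by rw [hadj]; exact hμ) κ hκ

/-- **(A)₂ for `288648g1` WITHOUT any print fact — ONE displayed INSTRUMENT INEQUALITY on ONE layer** (open-type row of the C1″ census:
`d = −16036`, `2 = 𝔭²𝔮`, `h = 1`; tower ranks 0 / 1 / 2 / 2): along every cyclotomic `ℤ₂`-extension of `ℚ(θ)` (`θ` any root of `X³ + (-1)X² + (1)X + (-49)`, `ℚ(P) = ℚ(θ)`),
`rank₂ Cl(layer 2) ≤ 2` — the `2`-rank of the class group of ONE number field of degree `12` (instrument tier: PARI `bnfinit`, GRH-conditional; cell TSVs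
`addL2x/gen8/conjA3_census_j300990_classes.tsv` / `conjA4_full_j301920_classes.tsv`). KERNEL: `n₀ = 0` (`forall_totallyRamifiedFrom_zero_h288648g1`), the tree's
ONE-LAYER SMALL-RANK CRITERION `classicalMuVanishes_of_lt_pow_sub_one` (`rank₂ Cl(K_j) < 2^j − 1 ⟹ μ₂ = 0`; Washington §13.3 / Fukuda, finite level) and the
μ-interface `conjA_two_288648g1_of_classicalMu`. Growth of the ranks BELOW layer `2` is irrelevant. No `hLim2`, no Fukuda fact, no ramification bit, no second layer.
BSD for `288648g1` is NOT proved by this. [cite: Washington1997, §13.3 Lemma 13.18 and Prop. 13.22–13.23] [cite: Fukuda1994, Thm. 1 (2), p. 264]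
[cite: CoatesSujatha2005, Conj. A and Thm. 3.4] -/
theorem conjA_two_288648g1_of_rankLe₂
    {θ : AlgebraicClosure ℚ} (hθ : aeval θ (Cubic.toPoly ⟨1, ((-1 : ℤ) : ℚ), ((1 : ℤ) : ℚ), ((-49 : ℤ) : ℚ)⟩) = 0)
    (h2 : haveI : FiniteDimensional ℚ (IntermediateField.adjoin ℚ {θ}) :=
        IntermediateField.adjoin.finiteDimensional ((AlgebraicClosure.isAlgebraic ℚ).isAlgebraic θ).isIntegral
      haveI : NumberField (IntermediateField.adjoin ℚ {θ}) := NumberField.mk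
      ∀ κL : ZpExtension (IntermediateField.adjoin ℚ {θ}) 2, κL.IsCyclotomic → classGroupPRank κL 2 ≤ 2)
    (κ : ZpExtension ℚ 2) (hκ : κ.IsCyclotomic) :
    haveI := (isElliptic_cubicModel _ _ _ (by simp only [Cubic.discr]; norm_num) : (⟨0, ((0 : ℤ) : ℚ), 0, ((-4738251 : ℤ) : ℚ), ((-2352695501738 : ℤ) : ℚ)⟩ : WeierstrassCurve ℚ).IsElliptic)
    ∃ (γ : absoluteGaloisGroup ℚ) (D : (⟨0, ((0 : ℤ) : ℚ), 0, ((-4738251 : ℤ) : ℚ), ((-2352695501738 : ℤ) : ℚ)⟩ : WeierstrassCurve ℚ).FineSelmerDualData κ γ),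
      Module.Finite ℤ_[2] (RestrictScalars ℤ_[2] (IwasawaAlgebra 2) D.X) := by
  haveI : FiniteDimensional ℚ (IntermediateField.adjoin ℚ {θ}) :=
    IntermediateField.adjoin.finiteDimensional ((AlgebraicClosure.isAlgebraic ℚ).isAlgebraic θ).isIntegral
  haveI : NumberField (IntermediateField.adjoin ℚ {θ}) := NumberField.mk
  exact conjA_two_288648g1_of_classicalMu hθ (fun κL hκL => classicalMuVanishes_of_lt_pow_sub_one κL
    (forall_totallyRamifiedFrom_zero_h288648g1 hθ κL hκL) le_rfl (j := 2) (by have h := h2 κL hκL; norm_num; omega)) κ hκ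

end Summit.BirchSwinnertonDyer.BirchSwinnertonDyer.Theorems.AddKatoTwo

/-! ## §2 The C3″ rungs (namespace `AddPotGoodInstances`) -/

namespace Summit.BirchSwinnertonDyer.BirchSwinnertonDyer.Theorems.AddPotGoodInstances

open WeierstrassCurve Polynomial Literature.NumberTheory.EllipticCurves
  Literature.NumberTheory.IwasawaTheory
  Literature.NumberTheory.EllipticCurves.Rank1Residual
  Literature.NumberTheory.EllipticCurves.Rank1Residual.Typed
  Summit.BirchSwinnertonDyer.Rank1Residual
  Summit.BirchSwinnertonDyer.Rank1Residual.Additive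
  Summit.BirchSwinnertonDyer.BirchSwinnertonDyer.Theorems

/-- Model transport for (A) at `2` in the `∃ γ D` spelling (the statement only depends on the Weierstrass CURVE).
[cite: CoatesSujatha2005, statement (A)] -/
private theorem conjA_two_of_eq'' {W W' : WeierstrassCurve ℚ} (h : W' = W)
    (H : ∀ (κ : ZpExtension ℚ 2), κ.IsCyclotomic →
      ∃ (γ : Field.absoluteGaloisGroup ℚ) (D : W'.FineSelmerDualData κ γ), Module.Finite ℤ_[2] (RestrictScalars ℤ_[2] (IwasawaAlgebra 2) D.X)) :
    ∀ (κ : ZpExtension ℚ 2), κ.IsCyclotomic →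
      ∃ (γ : Field.absoluteGaloisGroup ℚ) (D : W.FineSelmerDualData κ γ), Module.Finite ℤ_[2] (RestrictScalars ℤ_[2] (IwasawaAlgebra 2) D.X) := by
  subst h; exact H

/-! ## Row `315832c1` (Δ_cubic < 0, open type; stamp `AddKatoTwo.conjA_two_315832c1_of_rankLe₂` of §1) -/

/-- **(A) at `(315832c1, 2)` for the Cremona model from ONE displayed one-layer instrument inequality, NO print fact**: §1's
`AddKatoTwo.conjA_two_315832c1_of_rankLe₂` transported from its cast model to the literal model. [cite: CoatesSujatha2005, statement (A)] -/
theorem conjA_two_315832c1_of_rankLe₂_kernelLit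
    {θ : AlgebraicClosure ℚ} (hθ : aeval θ (Cubic.toPoly ⟨1, ((-1 : ℤ) : ℚ), ((-24 : ℤ) : ℚ), ((88 : ℤ) : ℚ)⟩) = 0)
    (h2 : haveI : FiniteDimensional ℚ (IntermediateField.adjoin ℚ {θ}) :=
        IntermediateField.adjoin.finiteDimensional ((AlgebraicClosure.isAlgebraic ℚ).isAlgebraic θ).isIntegral
      haveI : NumberField (IntermediateField.adjoin ℚ {θ}) := NumberField.mk
      ∀ κL : ZpExtension (IntermediateField.adjoin ℚ {θ}) 2, κL.IsCyclotomic → classGroupPRank κL 2 ≤ 2)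
    :
    haveI := isElliptic_315832c1
    ∀ (κ : ZpExtension ℚ 2), κ.IsCyclotomic →
      ∃ (γ : Field.absoluteGaloisGroup ℚ) (D : (⟨0, 0, 0, 79574117, 176712113750⟩ : WeierstrassCurve ℚ).FineSelmerDualData κ γ),
        Module.Finite ℤ_[2] (RestrictScalars ℤ_[2] (IwasawaAlgebra 2) D.X) :=
  conjA_two_of_eq'' (W' := (⟨0, ((0 : ℤ) : ℚ), 0, ((79574117 : ℤ) : ℚ), ((176712113750 : ℤ) : ℚ)⟩ : WeierstrassCurve ℚ)) (by norm_num) (fun κ hκ ↦ AddKatoTwo.conjA_two_315832c1_of_rankLe₂ hθ h2 κ hκ)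

/-- **`BSD₂(315832c1)` with (A) from ONE displayed one-layer instrument inequality and NO print fact for (A)**: GEN 3's rung `bsdp_two_315832c1_of_conjA` with `hA`
supplied by `conjA_two_315832c1_of_rankLe₂_kernelLit hθ h2`. Conditional on PRINT {`hSharp` (reading), `hGZK`, `hmod`, `hCT`}, the RECORD `hr`, `#Ш_an = q`
(`ord₂ q ≤ 6`), the two VALUED slots and ONE instrument inequality `h2`. Nothing booked; BSD is not proved by this.
[cite: Kato2004Asterisque, Thm. 12.5 (1)(3), 13.8, 14.14] [cite: Washington1997, §13.3 Prop. 13.23] [cite: Miller2011LMS, Def. 1.1] -/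
theorem bsdp_two_315832c1_rankLe₂
    (hSharp : Kato2004.rankZero_padicValNat_sha_add_padicValNat_tamagawa_le_at_two_of_irreducible_of_fineSelmerDual_fg)
    (hGZK : rank_eq_analyticRank_of_analyticRank_le_one) (hmod : hasEntireLFunction_rat)
    (hCT : exists_casselsTate_pairing (K := ℚ))
    {θ : AlgebraicClosure ℚ} (hθ : aeval θ (Cubic.toPoly ⟨1, ((-1 : ℤ) : ℚ), ((-24 : ℤ) : ℚ), ((88 : ℤ) : ℚ)⟩) = 0)
    (h2 : haveI : FiniteDimensional ℚ (IntermediateField.adjoin ℚ {θ}) :=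
        IntermediateField.adjoin.finiteDimensional ((AlgebraicClosure.isAlgebraic ℚ).isAlgebraic θ).isIntegral
      haveI : NumberField (IntermediateField.adjoin ℚ {θ}) := NumberField.mk
      ∀ κL : ZpExtension (IntermediateField.adjoin ℚ {θ}) 2, κL.IsCyclotomic → classGroupPRank κL 2 ≤ 2)
    (hr : haveI := isElliptic_315832c1; (⟨0, 0, 0, 79574117, 176712113750⟩ : WeierstrassCurve ℚ).analyticRank = 0)
    (hs₁ : Nat.card ((⟨0, 0, 0, 79574117, 176712113750⟩ : WeierstrassCurve ℚ).selmerGroup (2 ^ 2)) = 2 ^ 4)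
    (hs₂ : Nat.card ((⟨0, 0, 0, 79574117, 176712113750⟩ : WeierstrassCurve ℚ).selmerGroup (2 ^ (2 + 1))) = 2 ^ 6)
    {q : ℚ} (hq : haveI := isElliptic_315832c1; shaAn (⟨0, 0, 0, 79574117, 176712113750⟩ : WeierstrassCurve ℚ) = (q : ℂ)) (hv : padicValRat 2 q ≤ 6) :
    haveI := isElliptic_315832c1; haveI := isGloballyMinimal_315832c1
    BSDp (⟨0, 0, 0, 79574117, 176712113750⟩ : WeierstrassCurve ℚ) 2 := by
  exact bsdp_two_315832c1_of_conjA hSharp hGZK hmod hCT (conjA_two_315832c1_of_rankLe₂_kernelLit hθ h2) hr hs₁ hs₂ hq hv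

/-- **`BSD₂` ON THE WHOLE CLASS of `315832c1` with (A) from ONE displayed one-layer instrument inequality and NO print fact for (A)**: GEN 3's class rung
`bsdp_two_of_isIsogenous_315832c1_of_conjA` (Cassels transport `hCassels`) with `hA` from `conjA_two_315832c1_of_rankLe₂_kernelLit hθ h2`.
Nothing booked; BSD is not proved by this. [cite: Cassels1965ArithmeticVIII, Thm. 1.3] [cite: Kato2004Asterisque, Thm. 12.5 (1)(3)] [cite: Washington1997, §13.3 Prop. 13.23] -/
theorem bsdp_two_of_isIsogenous_315832c1_rankLe₂
    (hSharp : Kato2004.rankZero_padicValNat_sha_add_padicValNat_tamagawa_le_at_two_of_irreducible_of_fineSelmerDual_fg)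
    (hGZK : rank_eq_analyticRank_of_analyticRank_le_one) (hmod : hasEntireLFunction_rat)
    (hCT : exists_casselsTate_pairing (K := ℚ)) (hCassels : bsdRHS_eq_of_isIsogenous)
    {θ : AlgebraicClosure ℚ} (hθ : aeval θ (Cubic.toPoly ⟨1, ((-1 : ℤ) : ℚ), ((-24 : ℤ) : ℚ), ((88 : ℤ) : ℚ)⟩) = 0)
    (h2 : haveI : FiniteDimensional ℚ (IntermediateField.adjoin ℚ {θ}) :=
        IntermediateField.adjoin.finiteDimensional ((AlgebraicClosure.isAlgebraic ℚ).isAlgebraic θ).isIntegral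
      haveI : NumberField (IntermediateField.adjoin ℚ {θ}) := NumberField.mk
      ∀ κL : ZpExtension (IntermediateField.adjoin ℚ {θ}) 2, κL.IsCyclotomic → classGroupPRank κL 2 ≤ 2)
    {W : WeierstrassCurve ℚ} [W.IsElliptic] [W.IsGloballyMinimal]
    (hiso : haveI := isElliptic_315832c1; IsIsogenous W (⟨0, 0, 0, 79574117, 176712113750⟩ : WeierstrassCurve ℚ)) (hr : W.analyticRank = 0)
    (hs₁ : Nat.card ((⟨0, 0, 0, 79574117, 176712113750⟩ : WeierstrassCurve ℚ).selmerGroup (2 ^ 2)) = 2 ^ 4)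
    (hs₂ : Nat.card ((⟨0, 0, 0, 79574117, 176712113750⟩ : WeierstrassCurve ℚ).selmerGroup (2 ^ (2 + 1))) = 2 ^ 6)
    {q : ℚ} (hq : haveI := isElliptic_315832c1; shaAn (⟨0, 0, 0, 79574117, 176712113750⟩ : WeierstrassCurve ℚ) = (q : ℂ)) (hv : padicValRat 2 q ≤ 6) :
    BSDp W 2 := by
  exact bsdp_two_of_isIsogenous_315832c1_of_conjA hSharp hGZK hmod hCT hCassels (conjA_two_315832c1_of_rankLe₂_kernelLit hθ h2) hiso hr hs₁ hs₂ hq hv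

/-! ## Row `288648g1` (Δ_cubic < 0, open type; stamp `AddKatoTwo.conjA_two_288648g1_of_rankLe₂` of §1) -/

/-- **(A) at `(288648g1, 2)` for the Cremona model from ONE displayed one-layer instrument inequality, NO print fact**: §1's
`AddKatoTwo.conjA_two_288648g1_of_rankLe₂` transported from its cast model to the literal model. [cite: CoatesSujatha2005, statement (A)] -/
theorem conjA_two_288648g1_of_rankLe₂_kernelLit
    {θ : AlgebraicClosure ℚ} (hθ : aeval θ (Cubic.toPoly ⟨1, ((-1 : ℤ) : ℚ), ((1 : ℤ) : ℚ), ((-49 : ℤ) : ℚ)⟩) = 0)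
    (h2 : haveI : FiniteDimensional ℚ (IntermediateField.adjoin ℚ {θ}) :=
        IntermediateField.adjoin.finiteDimensional ((AlgebraicClosure.isAlgebraic ℚ).isAlgebraic θ).isIntegral
      haveI : NumberField (IntermediateField.adjoin ℚ {θ}) := NumberField.mk
      ∀ κL : ZpExtension (IntermediateField.adjoin ℚ {θ}) 2, κL.IsCyclotomic → classGroupPRank κL 2 ≤ 2)
    :
    haveI := isElliptic_288648g1
    ∀ (κ : ZpExtension ℚ 2), κ.IsCyclotomic →
      ∃ (γ : Field.absoluteGaloisGroup ℚ) (D : (⟨0, 0, 0, -4738251, -2352695501738⟩ : WeierstrassCurve ℚ).FineSelmerDualData κ γ),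
        Module.Finite ℤ_[2] (RestrictScalars ℤ_[2] (IwasawaAlgebra 2) D.X) :=
  conjA_two_of_eq'' (W' := (⟨0, ((0 : ℤ) : ℚ), 0, ((-4738251 : ℤ) : ℚ), ((-2352695501738 : ℤ) : ℚ)⟩ : WeierstrassCurve ℚ)) (by norm_num) (fun κ hκ ↦ AddKatoTwo.conjA_two_288648g1_of_rankLe₂ hθ h2 κ hκ)

/-- **`BSD₂(288648g1)` with (A) from ONE displayed one-layer instrument inequality and NO print fact for (A)**: GEN 3's rung `bsdp_two_288648g1_of_conjA` with `hA`
supplied by `conjA_two_288648g1_of_rankLe₂_kernelLit hθ h2`. Conditional on PRINT {`hSharp` (reading), `hGZK`, `hmod`, `hCT`}, the RECORD `hr`, `#Ш_an = q`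
(`ord₂ q ≤ 6`), the two VALUED slots and ONE instrument inequality `h2`. Nothing booked; BSD is not proved by this.
[cite: Kato2004Asterisque, Thm. 12.5 (1)(3), 13.8, 14.14] [cite: Washington1997, §13.3 Prop. 13.23] [cite: Miller2011LMS, Def. 1.1] -/
theorem bsdp_two_288648g1_rankLe₂
    (hSharp : Kato2004.rankZero_padicValNat_sha_add_padicValNat_tamagawa_le_at_two_of_irreducible_of_fineSelmerDual_fg)
    (hGZK : rank_eq_analyticRank_of_analyticRank_le_one) (hmod : hasEntireLFunction_rat)
    (hCT : exists_casselsTate_pairing (K := ℚ))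
    {θ : AlgebraicClosure ℚ} (hθ : aeval θ (Cubic.toPoly ⟨1, ((-1 : ℤ) : ℚ), ((1 : ℤ) : ℚ), ((-49 : ℤ) : ℚ)⟩) = 0)
    (h2 : haveI : FiniteDimensional ℚ (IntermediateField.adjoin ℚ {θ}) :=
        IntermediateField.adjoin.finiteDimensional ((AlgebraicClosure.isAlgebraic ℚ).isAlgebraic θ).isIntegral
      haveI : NumberField (IntermediateField.adjoin ℚ {θ}) := NumberField.mk
      ∀ κL : ZpExtension (IntermediateField.adjoin ℚ {θ}) 2, κL.IsCyclotomic → classGroupPRank κL 2 ≤ 2)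
    (hr : haveI := isElliptic_288648g1; (⟨0, 0, 0, -4738251, -2352695501738⟩ : WeierstrassCurve ℚ).analyticRank = 0)
    (hs₁ : Nat.card ((⟨0, 0, 0, -4738251, -2352695501738⟩ : WeierstrassCurve ℚ).selmerGroup (2 ^ 2)) = 2 ^ 4)
    (hs₂ : Nat.card ((⟨0, 0, 0, -4738251, -2352695501738⟩ : WeierstrassCurve ℚ).selmerGroup (2 ^ (2 + 1))) = 2 ^ 6)
    {q : ℚ} (hq : haveI := isElliptic_288648g1; shaAn (⟨0, 0, 0, -4738251, -2352695501738⟩ : WeierstrassCurve ℚ) = (q : ℂ)) (hv : padicValRat 2 q ≤ 6) :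
    haveI := isElliptic_288648g1; haveI := isGloballyMinimal_288648g1
    BSDp (⟨0, 0, 0, -4738251, -2352695501738⟩ : WeierstrassCurve ℚ) 2 := by
  exact bsdp_two_288648g1_of_conjA hSharp hGZK hmod hCT (conjA_two_288648g1_of_rankLe₂_kernelLit hθ h2) hr hs₁ hs₂ hq hv

/-- **`BSD₂` ON THE WHOLE CLASS of `288648g1` with (A) from ONE displayed one-layer instrument inequality and NO print fact for (A)**: GEN 3's class rung
`bsdp_two_of_isIsogenous_288648g1_of_conjA` (Cassels transport `hCassels`) with `hA` from `conjA_two_288648g1_of_rankLe₂_kernelLit hθ h2`.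
Nothing booked; BSD is not proved by this. [cite: Cassels1965ArithmeticVIII, Thm. 1.3] [cite: Kato2004Asterisque, Thm. 12.5 (1)(3)] [cite: Washington1997, §13.3 Prop. 13.23] -/
theorem bsdp_two_of_isIsogenous_288648g1_rankLe₂
    (hSharp : Kato2004.rankZero_padicValNat_sha_add_padicValNat_tamagawa_le_at_two_of_irreducible_of_fineSelmerDual_fg)
    (hGZK : rank_eq_analyticRank_of_analyticRank_le_one) (hmod : hasEntireLFunction_rat)
    (hCT : exists_casselsTate_pairing (K := ℚ)) (hCassels : bsdRHS_eq_of_isIsogenous)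
    {θ : AlgebraicClosure ℚ} (hθ : aeval θ (Cubic.toPoly ⟨1, ((-1 : ℤ) : ℚ), ((1 : ℤ) : ℚ), ((-49 : ℤ) : ℚ)⟩) = 0)
    (h2 : haveI : FiniteDimensional ℚ (IntermediateField.adjoin ℚ {θ}) :=
        IntermediateField.adjoin.finiteDimensional ((AlgebraicClosure.isAlgebraic ℚ).isAlgebraic θ).isIntegral
      haveI : NumberField (IntermediateField.adjoin ℚ {θ}) := NumberField.mk
      ∀ κL : ZpExtension (IntermediateField.adjoin ℚ {θ}) 2, κL.IsCyclotomic → classGroupPRank κL 2 ≤ 2)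
    {W : WeierstrassCurve ℚ} [W.IsElliptic] [W.IsGloballyMinimal]
    (hiso : haveI := isElliptic_288648g1; IsIsogenous W (⟨0, 0, 0, -4738251, -2352695501738⟩ : WeierstrassCurve ℚ)) (hr : W.analyticRank = 0)
    (hs₁ : Nat.card ((⟨0, 0, 0, -4738251, -2352695501738⟩ : WeierstrassCurve ℚ).selmerGroup (2 ^ 2)) = 2 ^ 4)
    (hs₂ : Nat.card ((⟨0, 0, 0, -4738251, -2352695501738⟩ : WeierstrassCurve ℚ).selmerGroup (2 ^ (2 + 1))) = 2 ^ 6)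
    {q : ℚ} (hq : haveI := isElliptic_288648g1; shaAn (⟨0, 0, 0, -4738251, -2352695501738⟩ : WeierstrassCurve ℚ) = (q : ℂ)) (hv : padicValRat 2 q ≤ 6) :
    BSDp W 2 := by
  exact bsdp_two_of_isIsogenous_288648g1_of_conjA hSharp hGZK hmod hCT hCassels (conjA_two_288648g1_of_rankLe₂_kernelLit hθ h2) hiso hr hs₁ hs₂ hq hv

end Summit.BirchSwinnertonDyer.BirchSwinnertonDyer.Theorems.AddPotGoodInstances

end
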